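import Literature.MathematicalPhysics.QuantumLattice.EnergyEntropyBalance
import Literature.MathematicalPhysics.QuantumLattice.BogoliubovInequalityGeneral
import HarnessLib

/-!
# Spectral (KMS-moment) correlation inequalities of finite Gibbs states: positive test functions against the spectral measure, and the Itoi–Ishimori–Sato–Sakamoto series

Topic `Literature/MathematicalPhysics/QuantumLattice` (thermal toolkit; companion of
`EnergyEntropyBalance.lean` (scalar EEB rows), `BogoliubovInequalityGeneral.lean`,
`DuhamelTwoPoint.lean`).

For a finite Gibbs state `⟨·⟩_β = tr(e^{-βH} ·)/Z` and ANY matrix `a`, all the moments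
`⟨aᴴ ad_H^k a⟩_β` and `⟨(ad_H^k a) aᴴ⟩_β` (`ad_H a = Ha − aH`) are integrals of `ω^k` against ONE
positive spectral measure: in an eigenbasis `H = U diag(E) U⋆`, with `a' = U⋆aU`, `wᵢ = e^{-βEᵢ}`,

  `Z ⟨aᴴ ad_H^k a⟩_β = Σᵢⱼ ‖a'ᵢⱼ‖² wⱼ (Eᵢ − Eⱼ)^k`,  `Z ⟨(ad_H^k a) aᴴ⟩_β = Σᵢⱼ ‖a'ᵢⱼ‖² wᵢ (Eᵢ − Eⱼ)^k`,

and `wᵢ = wⱼ e^{-β(Eᵢ−Eⱼ)}` (detailed balance). This is the spectral representation of Itoi–Ishimori–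
Sato–Sakamoto [ItoiEtAl2023, §3 (Q_{A,B}), Lemmas 1–3 and 5: `ω^{2k} Q_{A†,A} = Q_{C^k†,C^k}`,
`C_A^k = ad_H^k A`], which those authors use to derive their "extended series of correlation
inequalities" (Thms 1–4), containing the Bogoliubov–Harris, Brankov–Tonchev and Roepstorff
inequalities as first members. We prove:

* `Matrix.IsHermitian.kmsMomentRow_nonneg` — **the master inequality**: for every real `β`, every
  matrix `a`, every `K` and all real coefficients `p₀…p_K, q₀…q_K` such that the exponential polynomial
  `P(x) = Σₖ (pₖ + qₖ e^{-βx}) x^k` is `≥ 0` on `ℝ`,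
  `0 ≤ Σₖ (pₖ Re⟨aᴴ ad_H^k a⟩_β + qₖ Re⟨(ad_H^k a) aᴴ⟩_β)`.
  (Proof: the right-hand side is `Z⁻¹ Σᵢⱼ ‖a'ᵢⱼ‖² wⱼ P(Eᵢ − Eⱼ)`.) Every such `P` is therefore a LINEAR
  inequality ("row") in the local data `⟨aᴴ ad^k a⟩, ⟨(ad^k a) aᴴ⟩` of a Gibbs state; the tangent EEB rows
  of `EnergyEntropyBalance.lean` (`eeb_tangent_le`: `P(x) = βx − θ + e^{θ−1}e^{-βx}`) are the members of
  degree `(1, 0)`.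
* `Matrix.IsHermitian.re_gibbsState_doubleComm_le_half_beta_mul_anticomm` — Itoi–Ishimori–Sato–
  Sakamoto **Thm 3, case `n = 0`**: for `β ≥ 0`, `Re⟨[aᴴ,[H,a]]⟩_β ≤ (β/2)·Re⟨{[H,a]ᴴ,[H,a]}⟩_β`, the
  member `P(x) = (β/2)x²(1 + e^{-βx}) − x(1 − e^{-βx})` (i.e. `u ≥ tanh u`).
* `Matrix.IsHermitian.bogoliubov_harris` — the **Bogoliubov–Harris inequality** (Itoi et al. Thm 1,
  `n = 2`, upper bound): `½(Re⟨AAᴴ⟩ + Re⟨AᴴA⟩) − Re (A,Aᴴ)_Duh ≤ (β/12) Re⟨[Aᴴ,[H,A]]⟩`, via the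
  per-frequency inequality `half_add_exp_sub_duhamelKernel_le` (`u coth u ≤ 1 + u²/3`,
  `harris_core_nonneg`).

The pair-sum lemmas (`…_adPow…`) and the iterated commutator `Matrix.adPow` are stated for reuse by
certificate readers (the rows are the `β`-local constraints of thermal SDP relaxations, cf.
`GibbsEnergyEntropyBalance.lean`). Nothing is asserted about infinite systems here.

## References

* C. Itoi, H. Ishimori, K. Sato, Y. Sakamoto, *Extended Series of Correlation Inequalities in Quantum
  Systems*, J. Phys. Soc. Jpn. 92 (2023) 074001 = arXiv:2306.03489, §2 Thms 1–4, §3 Lemmas 1–6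
  [ItoiEtAl2023].
* F. J. Dyson, E. H. Lieb, B. Simon, J. Stat. Phys. 18 (1978) 335, §2–3 (Bogoliubov, Falk–Bruch)
  [DLS1978]; G. Roepstorff, Comm. Math. Phys. 53 (1977) [Roepstorff1978].
* H. Fawzi, O. Fawzi, S. O. Scalet, Nat. Commun. 15 (2024) 7394, §3 (EEB rows) [FawziFawziScalet2024].

## Mathlib / tree search

REUSED: `Matrix.gibbsState`, `Matrix.gibbsWeight`, `Matrix.IsHermitian.gibbsWeight_eq`,
`Matrix.IsHermitian.re_gibbsState`, `Matrix.trace_unitary_conj_mul`, `Matrix.star_unitary_mul_mul_mul`,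
`Matrix.trace_diagonal_mul_mul`, `Matrix.mul_star_eq_normSq_cast`,
`Matrix.IsHermitian.star_mul_self_mul_eq_diagonal` (`DuhamelTwoPoint.lean`); the pair sums of
`EnergyEntropyBalance.lean` are the `k = 0, 1` cases of the ones here. `lean search 'adPow|ad_H|
iterated commutator|doubleComm_le|harris|coth'` (2026-08-27): no iterated commutator on `Matrix`, no
higher-moment Gibbs inequality and no Bogoliubov–Harris inequality in the tree (the `coth` hits are the
Falk–Bruch / Kubo–Kishi bounds of `DuhamelTwoPoint.lean`, `HubbardKuboKishiBounds.lean`, which bound the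
Duhamel function from the OTHER side); `Matrix.duhamel`, `Matrix.duhamelKernel`,
`exp_sub_exp_eq_mul_duhamelKernel`, `min_exp_le_duhamelKernel` (`DuhamelTwoPoint.lean`),
`re_duhamel_conjTranspose_eq` (`DuhamelEqualTimeBounds.lean`), `re_gibbsState_doubleComm_general`
(`BogoliubovInequalityGeneral.lean`) are reused for the Harris member; Mathlib has `LieDerivation`/`ad` for Lie algebras but not the
matrix pair-sum form needed here, so a three-line recursive `Matrix.adPow` is introduced (dot-notation
extension of Mathlib's `Matrix` namespace, like `Matrix.gibbsState`).

## Design notes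

* Real `β` of either sign is allowed in the master inequality (as in `eeb_tangent_le`): only
  `wᵢ = wⱼ e^{-β(Eᵢ−Eⱼ)}` is used. The Itoi member needs `β ≥ 0`.
* The data are written with `Complex.re` (they ARE real: the pair sums are real casts).
-/

noncomputable section

open scoped Matrix.Norms.L2Operator ComplexOrder
open Finset Complex

namespace Matrix

variable {n : Type*} [Fintype n] [DecidableEq n]

/-- The iterated commutator `ad_H^k a`: `ad_H^0 a = a`, `ad_H^{k+1} a = H (ad_H^k a) − (ad_H^k a) H`
(the `C_A^k = [H,[H,⋯[H,A]⋯]]` of Itoi et al.). (Dot-notation extension of Mathlib's `Matrix`.)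
[cite: ItoiEtAl2023, §2 eq. (C_A^k)] -/
def adPow (H : Matrix n n ℂ) : ℕ → Matrix n n ℂ → Matrix n n ℂ
  | 0 => fun a => a
  | k + 1 => fun a => H * adPow H k a - adPow H k a * H

omit [Fintype n] [DecidableEq n] in
/-- `ad_H^0 a = a`. [cite: ItoiEtAl2023, §2 eq. (C_A^k)] -/
@[simp] theorem adPow_zero [Fintype n] (H a : Matrix n n ℂ) : adPow H 0 a = a := rfl

omit [Fintype n] [DecidableEq n] in
/-- `ad_H^{k+1} a = H (ad_H^k a) − (ad_H^k a) H`. [cite: ItoiEtAl2023, §2 eq. (C_A^k)] -/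
theorem adPow_succ [Fintype n] (H a : Matrix n n ℂ) (k : ℕ) :
    adPow H (k + 1) a = H * adPow H k a - adPow H k a * H := rfl

omit [Fintype n] [DecidableEq n] in
/-- `ad_H^1 a = Ha − aH`. [cite: ItoiEtAl2023, §2 eq. (C_A^k)] -/
@[simp] theorem adPow_one [Fintype n] (H a : Matrix n n ℂ) : adPow H 1 a = H * a - a * H := rfl

section Spectral

variable {H : Matrix n n ℂ}

/-- **`ad_H^k` is diagonal on the matrix units of an eigenbasis**: `(U⋆ (ad_H^k a) U)ᵢⱼ =
(Eᵢ − Eⱼ)^k (U⋆ a U)ᵢⱼ` (Itoi et al. Lemma 5: `⟨μ|C_A^k|ν⟩ = (E_μ − E_ν)^k ⟨μ|A|ν⟩`).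
[cite: ItoiEtAl2023, §3 Lemma 5 (proof)] -/
theorem IsHermitian.star_mul_adPow_mul_apply (hH : H.IsHermitian) (a : Matrix n n ℂ) (k : ℕ) (i j : n) :
    (star (hH.eigenvectorUnitary : Matrix n n ℂ) * adPow H k a *
        (hH.eigenvectorUnitary : Matrix n n ℂ)) i j =
      ((hH.eigenvalues i : ℂ) - (hH.eigenvalues j : ℂ)) ^ k *
        (star (hH.eigenvectorUnitary : Matrix n n ℂ) * a * (hH.eigenvectorUnitary : Matrix n n ℂ)) i j := by
  set U := (hH.eigenvectorUnitary : Matrix n n ℂ) with hU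
  have hUm : U ∈ unitary (Matrix n n ℂ) := hH.eigenvectorUnitary.prop
  set E : n → ℂ := fun i => (hH.eigenvalues i : ℂ) with hE
  have hdiag : star U * H * U = diagonal E := by
    rw [hU, hE]; exact hH.star_mul_self_mul_eq_diagonal
  induction k generalizing i j with
  | zero => simp
  | succ k ih =>
    have hrot : star U * adPow H (k + 1) a * U =
        diagonal E * (star U * adPow H k a * U) - (star U * adPow H k a * U) * diagonal E := by
      rw [adPow_succ, Matrix.mul_sub, Matrix.sub_mul, star_unitary_mul_mul_mul hUm,
        star_unitary_mul_mul_mul hUm, hdiag]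
    rw [hrot, sub_apply, diagonal_mul, mul_diagonal, ih i j, hE]
    ring

/-- **Pair-sum form of the `k`-th moment `⟨aᴴ ad_H^k a⟩`**:
`tr(e^{-βH} aᴴ (ad_H^k a)) = Σᵢⱼ ‖a'ᵢⱼ‖² e^{-βEⱼ} (Eᵢ − Eⱼ)^k`, `a' = U⋆aU` — the `k`-th moment of
the spectral function `Q_{A†,A}` of Itoi et al. (their Lemma 5 with Lemma 1).
[cite: ItoiEtAl2023, §3 Lemmas 1 and 5] -/
theorem IsHermitian.trace_gibbsWeight_mul_conjTranspose_mul_adPow (hH : H.IsHermitian)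
    (a : Matrix n n ℂ) (β : ℝ) (k : ℕ) :
    (gibbsWeight β H * (aᴴ * adPow H k a)).trace =
      ∑ i, ∑ j, ((‖(star (hH.eigenvectorUnitary : Matrix n n ℂ) * a *
          (hH.eigenvectorUnitary : Matrix n n ℂ)) i j‖ ^ 2 *
            Real.exp (-(β * hH.eigenvalues j)) * (hH.eigenvalues i - hH.eigenvalues j) ^ k : ℝ) : ℂ) := by
  set U := (hH.eigenvectorUnitary : Matrix n n ℂ) with hU
  have hUm : U ∈ unitary (Matrix n n ℂ) := hH.eigenvectorUnitary.prop
  set a' := star U * a * U with ha'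
  have hstar : star U * aᴴ * U = a'ᴴ := by
    rw [ha', conjTranspose_mul, conjTranspose_mul, star_eq_conjTranspose,
      conjTranspose_conjTranspose, Matrix.mul_assoc]
  have had : star U * adPow H k a * U = of fun i j => ((hH.eigenvalues i : ℂ) - hH.eigenvalues j) ^ k * a' i j := by
    ext i j
    rw [of_apply, hU, hH.star_mul_adPow_mul_apply a k i j]
  rw [hH.gibbsWeight_eq β, ← hU, trace_unitary_conj_mul, star_unitary_mul_mul_mul hUm, hstar, had,
    ← Matrix.mul_assoc, trace_diagonal_mul_mul]
  conv_lhs => rw [Finset.sum_comm]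
  refine sum_congr rfl fun i _ => sum_congr rfl fun j _ => ?_
  rw [conjTranspose_apply, of_apply]
  have : (Real.exp (-(β * hH.eigenvalues j)) : ℂ) * star (a' i j) *
      (((hH.eigenvalues i : ℂ) - hH.eigenvalues j) ^ k * a' i j) =
        (Real.exp (-(β * hH.eigenvalues j)) : ℂ) * (a' i j * star (a' i j)) *
          ((hH.eigenvalues i : ℂ) - hH.eigenvalues j) ^ k := by ring
  rw [this, mul_star_eq_normSq_cast]
  push_cast
  ring

/-- **Pair-sum form of the `k`-th moment `⟨(ad_H^k a) aᴴ⟩`**: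
`tr(e^{-βH} (ad_H^k a) aᴴ) = Σᵢⱼ ‖a'ᵢⱼ‖² e^{-βEᵢ} (Eᵢ − Eⱼ)^k` — the same weights with the Boltzmann
factor of the OTHER level (`e^{-βEᵢ} = e^{-βEⱼ} e^{-β(Eᵢ−Eⱼ)}`: the factor `e^{-βω}` in `Q_{A†,A}`).
[cite: ItoiEtAl2023, §3 Lemmas 1 and 5] -/
theorem IsHermitian.trace_gibbsWeight_mul_adPow_mul_conjTranspose (hH : H.IsHermitian)
    (a : Matrix n n ℂ) (β : ℝ) (k : ℕ) :
    (gibbsWeight β H * (adPow H k a * aᴴ)).trace =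
      ∑ i, ∑ j, ((‖(star (hH.eigenvectorUnitary : Matrix n n ℂ) * a *
          (hH.eigenvectorUnitary : Matrix n n ℂ)) i j‖ ^ 2 *
            Real.exp (-(β * hH.eigenvalues i)) * (hH.eigenvalues i - hH.eigenvalues j) ^ k : ℝ) : ℂ) := by
  set U := (hH.eigenvectorUnitary : Matrix n n ℂ) with hU
  have hUm : U ∈ unitary (Matrix n n ℂ) := hH.eigenvectorUnitary.prop
  set a' := star U * a * U with ha'
  have hstar : star U * aᴴ * U = a'ᴴ := by
    rw [ha', conjTranspose_mul, conjTranspose_mul, star_eq_conjTranspose,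
      conjTranspose_conjTranspose, Matrix.mul_assoc]
  have had : star U * adPow H k a * U = of fun i j => ((hH.eigenvalues i : ℂ) - hH.eigenvalues j) ^ k * a' i j := by
    ext i j
    rw [of_apply, hU, hH.star_mul_adPow_mul_apply a k i j]
  rw [hH.gibbsWeight_eq β, ← hU, trace_unitary_conj_mul, star_unitary_mul_mul_mul hUm, hstar, had,
    ← Matrix.mul_assoc, trace_diagonal_mul_mul]
  refine sum_congr rfl fun i _ => sum_congr rfl fun j _ => ?_
  rw [conjTranspose_apply, of_apply]
  have : (Real.exp (-(β * hH.eigenvalues i)) : ℂ) *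
      (((hH.eigenvalues i : ℂ) - hH.eigenvalues j) ^ k * a' i j) * star (a' i j) =
        (Real.exp (-(β * hH.eigenvalues i)) : ℂ) * (a' i j * star (a' i j)) *
          ((hH.eigenvalues i : ℂ) - hH.eigenvalues j) ^ k := by ring
  rw [this, mul_star_eq_normSq_cast]
  push_cast
  ring

/-- `Re⟨aᴴ ad_H^k a⟩_β = Z⁻¹ Σᵢⱼ ‖a'ᵢⱼ‖² e^{-βEⱼ} (Eᵢ − Eⱼ)^k` (real form of the pair sum).
[cite: ItoiEtAl2023, §3 Lemmas 1 and 5] -/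
theorem IsHermitian.re_gibbsState_conjTranspose_mul_adPow (hH : H.IsHermitian) (a : Matrix n n ℂ)
    (β : ℝ) (k : ℕ) :
    (gibbsState β H (aᴴ * adPow H k a)).re = (∑ i, Real.exp (-(β * hH.eigenvalues i)))⁻¹ *
      ∑ i, ∑ j, ‖(star (hH.eigenvectorUnitary : Matrix n n ℂ) * a *
          (hH.eigenvectorUnitary : Matrix n n ℂ)) i j‖ ^ 2 *
            Real.exp (-(β * hH.eigenvalues j)) * (hH.eigenvalues i - hH.eigenvalues j) ^ k := by
  rw [hH.re_gibbsState, hH.trace_gibbsWeight_mul_conjTranspose_mul_adPow]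
  congr 1
  simp_rw [← Complex.ofReal_sum]
  rw [Complex.ofReal_re]

/-- `Re⟨(ad_H^k a) aᴴ⟩_β = Z⁻¹ Σᵢⱼ ‖a'ᵢⱼ‖² e^{-βEᵢ} (Eᵢ − Eⱼ)^k` (real form of the pair sum).
[cite: ItoiEtAl2023, §3 Lemmas 1 and 5] -/
theorem IsHermitian.re_gibbsState_adPow_mul_conjTranspose (hH : H.IsHermitian) (a : Matrix n n ℂ)
    (β : ℝ) (k : ℕ) :
    (gibbsState β H (adPow H k a * aᴴ)).re = (∑ i, Real.exp (-(β * hH.eigenvalues i)))⁻¹ *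
      ∑ i, ∑ j, ‖(star (hH.eigenvectorUnitary : Matrix n n ℂ) * a *
          (hH.eigenvectorUnitary : Matrix n n ℂ)) i j‖ ^ 2 *
            Real.exp (-(β * hH.eigenvalues i)) * (hH.eigenvalues i - hH.eigenvalues j) ^ k := by
  rw [hH.re_gibbsState, hH.trace_gibbsWeight_mul_adPow_mul_conjTranspose]
  congr 1
  simp_rw [← Complex.ofReal_sum]
  rw [Complex.ofReal_re]

/-- **The master spectral inequality (KMS-moment rows).** For a Hermitian `H`, EVERY real `β`,
every matrix `a`, every order `K` and all real coefficients `p q : ℕ → ℝ` such that the exponential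
polynomial `P(x) = Σ_{k ≤ K} (pₖ + qₖ e^{-βx}) x^k` is nonnegative on `ℝ`,
`0 ≤ Σ_{k ≤ K} (pₖ · Re⟨aᴴ ad_H^k a⟩_β + qₖ · Re⟨(ad_H^k a) aᴴ⟩_β)`.
Proof: by the two pair sums and detailed balance `e^{-βEᵢ} = e^{-βEⱼ} e^{-β(Eᵢ−Eⱼ)}` the right-hand
side equals `Z⁻¹ Σᵢⱼ ‖a'ᵢⱼ‖² e^{-βEⱼ} P(Eᵢ − Eⱼ) ≥ 0`. This is the general principle behind the
series of Itoi et al. (each of their Thms 1–4 integrates a sign-definite function against `Q_{A†,A}`);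
the tangent EEB rows (`eeb_tangent_le`) are the case `K = 1`, `P(x) = βx − θ + e^{θ−1}e^{-βx}`.
[cite: ItoiEtAl2023, §3 Lemmas 1–3, 5 and proof of Thm 3 (positivity of the integrand against Q_{A†,A})] -/
theorem IsHermitian.kmsMomentRow_nonneg (hH : H.IsHermitian) (β : ℝ) (a : Matrix n n ℂ) (K : ℕ)
    (p q : ℕ → ℝ)
    (hP : ∀ x : ℝ, 0 ≤ ∑ k ∈ Finset.range (K + 1), (p k + q k * Real.exp (-(β * x))) * x ^ k) :
    0 ≤ ∑ k ∈ Finset.range (K + 1),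
      (p k * (gibbsState β H (aᴴ * adPow H k a)).re +
        q k * (gibbsState β H (adPow H k a * aᴴ)).re) := by
  set U := (hH.eigenvectorUnitary : Matrix n n ℂ) with hU
  set m : n → n → ℝ := fun i j => ‖(star U * a * U) i j‖ ^ 2 with hm
  set w : n → ℝ := fun i => Real.exp (-(β * hH.eigenvalues i)) with hw
  set E : n → ℝ := fun i => hH.eigenvalues i with hE
  set Z : ℝ := (∑ i, w i)⁻¹ with hZdef
  have hZ : 0 ≤ Z := inv_nonneg.mpr (sum_nonneg fun i _ => (Real.exp_pos _).le)
  have hwij : ∀ i j, w i = w j * Real.exp (-(β * (E i - E j))) := by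
    intro i j
    simp only [hw, hE, ← Real.exp_add]
    ring_nf
  have hmk : ∀ k, (gibbsState β H (aᴴ * adPow H k a)).re =
      Z * ∑ i, ∑ j, m i j * w j * (E i - E j) ^ k := fun k =>
    hH.re_gibbsState_conjTranspose_mul_adPow a β k
  have hnk : ∀ k, (gibbsState β H (adPow H k a * aᴴ)).re =
      Z * ∑ i, ∑ j, m i j * w i * (E i - E j) ^ k := fun k =>
    hH.re_gibbsState_adPow_mul_conjTranspose a β k
  have key : ∑ k ∈ Finset.range (K + 1),
      (p k * (gibbsState β H (aᴴ * adPow H k a)).re + q k * (gibbsState β H (adPow H k a * aᴴ)).re) =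
      ∑ i, ∑ j, Z * (m i j * w j) *
        ∑ k ∈ Finset.range (K + 1), (p k + q k * Real.exp (-(β * (E i - E j)))) * (E i - E j) ^ k := by
    have step : ∀ k, p k * (gibbsState β H (aᴴ * adPow H k a)).re +
        q k * (gibbsState β H (adPow H k a * aᴴ)).re =
        ∑ i, ∑ j, Z * (m i j * w j) * ((p k + q k * Real.exp (-(β * (E i - E j)))) * (E i - E j) ^ k) := by
      intro k
      rw [hmk k, hnk k, Finset.mul_sum, Finset.mul_sum, Finset.mul_sum, Finset.mul_sum,
        ← Finset.sum_add_distrib]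
      refine sum_congr rfl fun i _ => ?_
      rw [Finset.mul_sum, Finset.mul_sum, Finset.mul_sum, Finset.mul_sum, ← Finset.sum_add_distrib]
      refine sum_congr rfl fun j _ => ?_
      rw [hwij i j]
      ring
    simp_rw [step]
    rw [Finset.sum_comm]
    refine sum_congr rfl fun i _ => ?_
    rw [Finset.sum_comm]
    refine sum_congr rfl fun j _ => ?_
    rw [Finset.mul_sum]
  rw [key]
  exact sum_nonneg fun i _ => sum_nonneg fun j _ =>
    mul_nonneg (mul_nonneg hZ (mul_nonneg (sq_nonneg _) (Real.exp_pos _).le)) (hP _)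

/-! ### The first member beyond EEB: Itoi–Ishimori–Sato–Sakamoto Thm 3 (`n = 0`) -/

/-- Rotated entries of `ad_H^k a` have squared norm `((Eᵢ − Eⱼ)²)^k ‖a'ᵢⱼ‖²` (Itoi et al. Lemma 5:
`Q_{C^k†,C^k}(ω) = ω^{2k} Q_{A†,A}(ω)`). [cite: ItoiEtAl2023, §3 Lemma 5] -/
theorem IsHermitian.norm_sq_star_mul_adPow_mul_apply (hH : H.IsHermitian) (a : Matrix n n ℂ) (k : ℕ)
    (i j : n) :
    ‖(star (hH.eigenvectorUnitary : Matrix n n ℂ) * adPow H k a *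
        (hH.eigenvectorUnitary : Matrix n n ℂ)) i j‖ ^ 2 =
      ((hH.eigenvalues i - hH.eigenvalues j) ^ 2) ^ k *
        ‖(star (hH.eigenvectorUnitary : Matrix n n ℂ) * a * (hH.eigenvectorUnitary : Matrix n n ℂ)) i j‖ ^ 2 := by
  rw [hH.star_mul_adPow_mul_apply a k i j, norm_mul, norm_pow, ← Complex.ofReal_sub,
    Complex.norm_real, Real.norm_eq_abs, mul_pow, ← pow_mul, mul_comm k 2, pow_mul, sq_abs]

/-- Calculus core of the `n = 0` member: `e^v − 1 ≤ (v/2)(e^v + 1)` for `v ≥ 0`, i.e.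
`tanh(v/2) ≤ v/2` (the function `f₀(x) = x coth x − 1 ≥ 0` of Itoi et al. Lemma 6).
Proof: `φ(v) = (v/2)(e^v + 1) − (e^v − 1)` has `φ(0) = 0` and `φ' = (1 + (v − 1)e^v)/2 ≥ 0`
(`(1 − v)e^v ≤ 1`). [cite: ItoiEtAl2023, §3 Lemma 6 (f₀ ≥ 0)] -/
theorem exp_sub_one_le_half_mul_exp_add_one {v : ℝ} (hv : 0 ≤ v) :
    Real.exp v - 1 ≤ v / 2 * (Real.exp v + 1) := by
  let φ : ℝ → ℝ := fun u => u / 2 * (Real.exp u + 1) - (Real.exp u - 1)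
  have hderiv : ∀ u, HasDerivAt φ ((1 + (u - 1) * Real.exp u) / 2) u := by
    intro u
    have h1 : HasDerivAt (fun u : ℝ => u / 2 * (Real.exp u + 1))
        (1 / 2 * (Real.exp u + 1) + u / 2 * Real.exp u) u :=
      ((hasDerivAt_id u).div_const 2).mul ((Real.hasDerivAt_exp u).add_const 1)
    have h2 : HasDerivAt (fun u : ℝ => Real.exp u - 1) (Real.exp u) u :=
      (Real.hasDerivAt_exp u).sub_const 1
    exact (h1.sub h2).congr_deriv (by ring)
  have hmono : MonotoneOn φ (Set.Ici 0) := by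
    refine monotoneOn_of_deriv_nonneg (convex_Ici 0)
      (fun u _ => (hderiv u).continuousAt.continuousWithinAt)
      (fun u _ => (hderiv u).differentiableAt.differentiableWithinAt) ?_
    intro u hu
    rw [interior_Ici] at hu
    rw [(hderiv u).deriv]
    have hexp : (1 - u) * Real.exp u ≤ 1 := by
      have h := Real.add_one_le_exp (-u)
      have hpos := Real.exp_pos u
      calc (1 - u) * Real.exp u ≤ Real.exp (-u) * Real.exp u := by
            apply mul_le_mul_of_nonneg_right _ hpos.le; linarith
        _ = 1 := by rw [← Real.exp_add]; simp
    linarith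
  have h0 : φ 0 = 0 := by simp [φ]
  have h := hmono Set.self_mem_Ici (Set.mem_Ici.2 hv) hv
  rw [h0] at h
  simp only [φ] at h
  linarith

/-- **The per-frequency inequality of the `n = 0` member**, for every real `u`:
`u(1 − e^{-u}) ≤ (u²/2)(1 + e^{-u})` — the nonnegativity on `ℝ` of the exponential polynomial
`P(x) = (β/2)x²(1 + e^{-βx}) − x(1 − e^{-βx})` at `u = βx`, equivalently `(u/2) coth(u/2) ≥ 1`.
[cite: ItoiEtAl2023, §3 Lemma 6 (f₀ ≥ 0) and proof of Thm 3] -/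
theorem mul_one_sub_exp_neg_le_sq (u : ℝ) :
    u * (1 - Real.exp (-u)) ≤ u ^ 2 / 2 * (1 + Real.exp (-u)) := by
  rcases le_total 0 u with hu | hu
  · -- multiply `e^u − 1 ≤ (u/2)(e^u + 1)` by `u e^{-u} ≥ 0`
    have h := exp_sub_one_le_half_mul_exp_add_one hu
    have hw : 0 ≤ u * Real.exp (-u) := mul_nonneg hu (Real.exp_pos _).le
    have key := mul_le_mul_of_nonneg_left h hw
    have e1 : Real.exp (-u) * Real.exp u = 1 := by rw [← Real.exp_add]; simp
    have lhs : u * Real.exp (-u) * (Real.exp u - 1) = u * (1 - Real.exp (-u)) := by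
      calc u * Real.exp (-u) * (Real.exp u - 1) = u * (Real.exp (-u) * Real.exp u - Real.exp (-u)) := by ring
        _ = u * (1 - Real.exp (-u)) := by rw [e1]
    have rhs : u * Real.exp (-u) * (u / 2 * (Real.exp u + 1)) = u ^ 2 / 2 * (1 + Real.exp (-u)) := by
      calc u * Real.exp (-u) * (u / 2 * (Real.exp u + 1))
          = u ^ 2 / 2 * (Real.exp (-u) * Real.exp u + Real.exp (-u)) := by ring
        _ = u ^ 2 / 2 * (1 + Real.exp (-u)) := by rw [e1]
    rw [lhs, rhs] at key
    exact key
  · -- `u ≤ 0`: with `v = -u ≥ 0` this is `v(e^v − 1) ≤ (v²/2)(e^v + 1)`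
    have hv : 0 ≤ -u := neg_nonneg.2 hu
    have h := exp_sub_one_le_half_mul_exp_add_one hv
    have key := mul_le_mul_of_nonneg_left h hv
    have lhs : -u * (Real.exp (-u) - 1) = u * (1 - Real.exp (-u)) := by ring
    have rhs : -u * (-u / 2 * (Real.exp (-u) + 1)) = u ^ 2 / 2 * (1 + Real.exp (-u)) := by ring
    rw [lhs, rhs] at key
    exact key

omit [Fintype n] [DecidableEq n] in
/-- Per-pair form with Boltzmann weights: for `β ≥ 0`, `m ≥ 0`, levels `Eᵢ, Eⱼ` and
`x = Eᵢ − Eⱼ`, `m(e^{-βEⱼ} − e^{-βEᵢ})x ≤ (β/2) m x² (e^{-βEⱼ} + e^{-βEᵢ})`.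
[cite: ItoiEtAl2023, §3 proof of Thm 3 (integrand positivity)] -/
private theorem itoi3_pair_le {β : ℝ} (hβ : 0 ≤ β) (Ei Ej m : ℝ) (hm : 0 ≤ m) :
    m * (Real.exp (-(β * Ej)) - Real.exp (-(β * Ei))) * (Ei - Ej) ≤
      β / 2 * (m * (Ei - Ej) ^ 2 * (Real.exp (-(β * Ej)) + Real.exp (-(β * Ei)))) := by
  have hw : 0 ≤ m * Real.exp (-(β * Ej)) := mul_nonneg hm (Real.exp_pos _).le
  have he : Real.exp (-(β * Ei)) = Real.exp (-(β * Ej)) * Real.exp (-(β * (Ei - Ej))) := by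
    rw [← Real.exp_add]; ring_nf
  rcases eq_or_lt_of_le hβ with hb | hb
  · subst hb; simp
  · have h := mul_one_sub_exp_neg_le_sq (β * (Ei - Ej))
    -- divide by β > 0 and multiply by the weight
    have h' : (Ei - Ej) * (1 - Real.exp (-(β * (Ei - Ej)))) ≤
        β / 2 * (Ei - Ej) ^ 2 * (1 + Real.exp (-(β * (Ei - Ej)))) := by
      have h2 : β * ((Ei - Ej) * (1 - Real.exp (-(β * (Ei - Ej))))) ≤
          β * (β / 2 * (Ei - Ej) ^ 2 * (1 + Real.exp (-(β * (Ei - Ej))))) := by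
        convert h using 1 <;> ring
      exact le_of_mul_le_mul_left h2 hb
    have key := mul_le_mul_of_nonneg_left h' hw
    rw [he]
    have e1 : m * (Real.exp (-(β * Ej)) - Real.exp (-(β * Ej)) * Real.exp (-(β * (Ei - Ej)))) * (Ei - Ej)
        = m * Real.exp (-(β * Ej)) * ((Ei - Ej) * (1 - Real.exp (-(β * (Ei - Ej))))) := by ring
    have e2 : β / 2 * (m * (Ei - Ej) ^ 2 * (Real.exp (-(β * Ej)) + Real.exp (-(β * Ej)) * Real.exp (-(β * (Ei - Ej)))))
        = m * Real.exp (-(β * Ej)) * (β / 2 * (Ei - Ej) ^ 2 * (1 + Real.exp (-(β * (Ei - Ej))))) := by ring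
    rw [e1, e2]
    exact key

/-- **Itoi–Ishimori–Sato–Sakamoto Theorem 3, case `n = 0`, for finite Gibbs states.** For a Hermitian
`H`, `β ≥ 0` and ANY matrix `a`, with `c = [H, a] = Ha − aH`,
`Re⟨[aᴴ, c]⟩_β = Re⟨aᴴc − caᴴ⟩_β ≤ (β/2) · Re⟨cᴴc + ccᴴ⟩_β = (β/2) · Re⟨{[H,a]ᴴ, [H,a]}⟩_β`
— printed as `⟨[A†,[H,A]]⟩ ≤ (β/2)⟨{[H,A]†,[H,A]}⟩` ("new inequality", eq. after Thm 3). It is the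
KMS-moment row of the exponential polynomial `P(x) = (β/2)x²(1 + e^{-βx}) − x(1 − e^{-βx}) ≥ 0`
(`mul_one_sub_exp_neg_le_sq`): a LINEAR inequality between second-order data `⟨cᴴc⟩, ⟨ccᴴ⟩` and
the double commutator, complementing the Bogoliubov/EEB first-order rows (the double commutator is
`≥ 0`, `Matrix.re_gibbsState_doubleComm_general_nonneg`; here it is bounded ABOVE).
[cite: ItoiEtAl2023, §2 Thm 3 (n = 0 case, displayed inequality following Thm 3) and §3 proof of Thm 3] -/
theorem IsHermitian.re_gibbsState_doubleComm_le_half_beta_mul_anticomm (hH : H.IsHermitian) {β : ℝ}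
    (hβ : 0 ≤ β) (a : Matrix n n ℂ) :
    (gibbsState β H (aᴴ * (H * a - a * H) - (H * a - a * H) * aᴴ)).re ≤
      β / 2 * (gibbsState β H ((H * a - a * H)ᴴ * (H * a - a * H) +
        (H * a - a * H) * (H * a - a * H)ᴴ)).re := by
  set U := (hH.eigenvectorUnitary : Matrix n n ℂ) with hU
  set m : n → n → ℝ := fun i j => ‖(star U * a * U) i j‖ ^ 2 with hm
  set w : n → ℝ := fun i => Real.exp (-(β * hH.eigenvalues i)) with hw
  set E : n → ℝ := fun i => hH.eigenvalues i with hE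
  have hZ : 0 ≤ (∑ i, w i)⁻¹ := inv_nonneg.mpr (sum_nonneg fun i _ => (Real.exp_pos _).le)
  have hc : H * a - a * H = adPow H 1 a := rfl
  -- the four moments as pair sums
  have h1 : (gibbsState β H (aᴴ * (H * a - a * H))).re =
      (∑ i, w i)⁻¹ * ∑ i, ∑ j, m i j * w j * (E i - E j) ^ 1 := by
    rw [hc]; exact hH.re_gibbsState_conjTranspose_mul_adPow a β 1
  have h2 : (gibbsState β H ((H * a - a * H) * aᴴ)).re =
      (∑ i, w i)⁻¹ * ∑ i, ∑ j, m i j * w i * (E i - E j) ^ 1 := by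
    rw [hc]; exact hH.re_gibbsState_adPow_mul_conjTranspose a β 1
  have h3 : (gibbsState β H ((H * a - a * H)ᴴ * (H * a - a * H))).re =
      (∑ i, w i)⁻¹ * ∑ i, ∑ j, m i j * w j * (E i - E j) ^ 2 := by
    rw [hc, hH.re_gibbsState_conjTranspose_mul_self (adPow H 1 a) β]
    refine congrArg (fun t => (∑ i, w i)⁻¹ * t) (sum_congr rfl fun i _ => sum_congr rfl fun j _ => ?_)
    rw [← hU, hH.norm_sq_star_mul_adPow_mul_apply a 1 i j, pow_one]
    simp only [hm, hw, hE]; ring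
  have h4 : (gibbsState β H ((H * a - a * H) * (H * a - a * H)ᴴ)).re =
      (∑ i, w i)⁻¹ * ∑ i, ∑ j, m i j * w i * (E i - E j) ^ 2 := by
    rw [hc, hH.re_gibbsState_self_mul_conjTranspose (adPow H 1 a) β]
    refine congrArg (fun t => (∑ i, w i)⁻¹ * t) (sum_congr rfl fun i _ => sum_congr rfl fun j _ => ?_)
    rw [← hU, hH.norm_sq_star_mul_adPow_mul_apply a 1 i j, pow_one]
    simp only [hm, hw, hE]; ring
  -- per pair
  have key : ∑ i, ∑ j, (m i j * w j * (E i - E j) ^ 1 - m i j * w i * (E i - E j) ^ 1) ≤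
      ∑ i, ∑ j, (β / 2 * (m i j * w j * (E i - E j) ^ 2 + m i j * w i * (E i - E j) ^ 2)) := by
    refine sum_le_sum fun i _ => sum_le_sum fun j _ => ?_
    have h := itoi3_pair_le hβ (E i) (E j) (m i j) (sq_nonneg _)
    simp only [hw, hE, pow_one] at h ⊢
    linarith [h]
  set S1 := ∑ i, ∑ j, m i j * w j * (E i - E j) ^ 1 with hS1
  set S2 := ∑ i, ∑ j, m i j * w i * (E i - E j) ^ 1 with hS2
  set S3 := ∑ i, ∑ j, m i j * w j * (E i - E j) ^ 2 with hS3
  set S4 := ∑ i, ∑ j, m i j * w i * (E i - E j) ^ 2 with hS4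
  set Z := (∑ i, w i)⁻¹ with hZdef
  have key' : S1 - S2 ≤ β / 2 * (S3 + S4) := by
    have eq1 : S1 - S2 = ∑ i, ∑ j, (m i j * w j * (E i - E j) ^ 1 - m i j * w i * (E i - E j) ^ 1) := by
      rw [hS1, hS2, ← sum_sub_distrib]
      exact sum_congr rfl fun i _ => (sum_sub_distrib _ _).symm
    have eq2 : β / 2 * (S3 + S4) =
        ∑ i, ∑ j, (β / 2 * (m i j * w j * (E i - E j) ^ 2 + m i j * w i * (E i - E j) ^ 2)) := by
      rw [hS3, hS4, ← sum_add_distrib, Finset.mul_sum]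
      refine sum_congr rfl fun i _ => ?_
      rw [← sum_add_distrib, Finset.mul_sum]
    rw [eq1, eq2]
    exact key
  rw [map_sub, Complex.sub_re, map_add, Complex.add_re, h1, h2, h3, h4]
  have hfin := mul_le_mul_of_nonneg_left key' hZ
  calc Z * S1 - Z * S2 = Z * (S1 - S2) := by ring
    _ ≤ Z * (β / 2 * (S3 + S4)) := hfin
    _ = β / 2 * (Z * S3 + Z * S4) := by ring

/-! ### The Duhamel members: Bogoliubov–Harris (Itoi et al. Thm 1, `n = 2`, upper bound) -/

/-- From `f(0) = 0` and `f' ≥ 0` on `[0, ∞)` to `f ≥ 0` on `[0, ∞)` (mean value). [folklore] -/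
private theorem nonneg_of_hasDerivAt_nonneg {f f' : ℝ → ℝ} (hf : ∀ x, HasDerivAt f (f' x) x)
    (h0 : f 0 = 0) (hpos : ∀ x, 0 ≤ x → 0 ≤ f' x) {x : ℝ} (hx : 0 ≤ x) : 0 ≤ f x := by
  have hmono : MonotoneOn f (Set.Ici 0) := by
    refine monotoneOn_of_deriv_nonneg (convex_Ici 0)
      (fun u _ => (hf u).continuousAt.continuousWithinAt)
      (fun u _ => (hf u).differentiableAt.differentiableWithinAt) ?_
    intro u hu
    rw [interior_Ici] at hu
    rw [(hf u).deriv]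
    exact hpos u (le_of_lt hu)
  have h := hmono Set.self_mem_Ici (Set.mem_Ici.2 hx) hx
  rwa [h0] at h

/-- Calculus core of the Bogoliubov–Harris inequality: `ψ(v) = (v² + 12)(e^v − 1) − 6v(e^v + 1) ≥ 0`
for `v ≥ 0` (power series `Σ_{k≥5} (k−3)(k−4)/k! · v^k`; equivalently `v coth v ≤ 1 + v²/3` at
`v/2`, the sign of `f₂` in Itoi et al. Lemma 6). Proof: `ψ`, `ψ⁽¹⁾`, `ψ⁽²⁾` vanish at `0` and
`ψ⁽³⁾ = v² e^v ≥ 0`. [cite: ItoiEtAl2023, §3 Lemma 6 (sign of f₂)] -/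
theorem harris_core_nonneg {v : ℝ} (hv : 0 ≤ v) :
    0 ≤ (v ^ 2 + 12) * (Real.exp v - 1) - 6 * v * (Real.exp v + 1) := by
  -- ψ⁽²⁾ = (v² − 2v + 2) e^v − 2 ≥ 0
  have h2 : ∀ x, 0 ≤ x → 0 ≤ (x ^ 2 - 2 * x + 2) * Real.exp x - 2 := by
    intro x hx
    refine nonneg_of_hasDerivAt_nonneg (f := fun x => (x ^ 2 - 2 * x + 2) * Real.exp x - 2)
      (f' := fun x => x ^ 2 * Real.exp x) (fun x => ?_) (by norm_num) (fun x _ => by positivity) hx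
    have h := ((((hasDerivAt_pow 2 x).sub ((hasDerivAt_id x).const_mul 2)).add_const 2).mul
      (Real.hasDerivAt_exp x)).sub_const 2
    refine h.congr_deriv ?_
    simp only [Nat.cast_ofNat, id_eq, Pi.sub_apply]
    ring
  -- ψ⁽¹⁾ = (v² − 4v + 6) e^v − 2v − 6 ≥ 0
  have h1 : ∀ x, 0 ≤ x → 0 ≤ (x ^ 2 - 4 * x + 6) * Real.exp x - 2 * x - 6 := by
    intro x hx
    refine nonneg_of_hasDerivAt_nonneg (f := fun x => (x ^ 2 - 4 * x + 6) * Real.exp x - 2 * x - 6)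
      (f' := fun x => (x ^ 2 - 2 * x + 2) * Real.exp x - 2) (fun x => ?_) (by norm_num) h2 hx
    have h := (((((hasDerivAt_pow 2 x).sub ((hasDerivAt_id x).const_mul 4)).add_const 6).mul
      (Real.hasDerivAt_exp x)).sub ((hasDerivAt_id x).const_mul 2)).sub_const 6
    refine h.congr_deriv ?_
    simp only [Nat.cast_ofNat, id_eq, Pi.sub_apply]
    ring
  -- ψ
  refine nonneg_of_hasDerivAt_nonneg (f := fun x => (x ^ 2 + 12) * (Real.exp x - 1) - 6 * x * (Real.exp x + 1))
    (f' := fun x => (x ^ 2 - 4 * x + 6) * Real.exp x - 2 * x - 6) (fun x => ?_) (by norm_num) h1 hv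
  have h := (((hasDerivAt_pow 2 x).add_const 12).mul ((Real.hasDerivAt_exp x).sub_const 1)).sub
    (((hasDerivAt_id x).const_mul 6).mul ((Real.hasDerivAt_exp x).add_const 1))
  refine h.congr_deriv ?_
  simp only [Nat.cast_ofNat, id_eq]
  ring

/-- **Per-frequency form of the Bogoliubov–Harris inequality.** With `a = e^{-βx}`, `b = e^{-βy}` and
the Duhamel kernel `K = K_β(x,y)` (`Matrix.duhamelKernel`; `a − b = β(y−x)K`): for EVERY real `β`,
`(a + b)/2 − K ≤ (β/12)·(y − x)(a − b)`, i.e. `f(u) = u coth u ≤ 1 + u²/3` at `u = β(x−y)/2`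
(Itoi et al.: "the upper bound is known as the Bogoliubov–Harris inequality").
[cite: ItoiEtAl2023, §2 inequality following Thm 4 (n = 2 case of Thm 1, upper bound) and §3 Lemma 6] -/
theorem half_add_exp_sub_duhamelKernel_le (β x y : ℝ) :
    (Real.exp (-(β * x)) + Real.exp (-(β * y))) / 2 - duhamelKernel β x y ≤
      β / 12 * ((y - x) * (Real.exp (-(β * x)) - Real.exp (-(β * y)))) := by
  have hid := exp_sub_exp_eq_mul_duhamelKernel β x y   -- a − b = β(y−x) K
  have hKmin := min_exp_le_duhamelKernel β x y
  have hapos : 0 < Real.exp (-(β * x)) := Real.exp_pos _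
  have hb : Real.exp (-(β * y)) = Real.exp (-(β * x)) * Real.exp (-(β * (y - x))) := by
    rw [← Real.exp_add]; ring_nf
  have hrhs : β / 12 * ((y - x) * (Real.exp (-(β * x)) - Real.exp (-(β * y)))) =
      (β * (y - x)) / 12 * (Real.exp (-(β * x)) - Real.exp (-(β * y))) := by ring
  rw [hrhs]
  rw [hb] at hid hKmin ⊢
  generalize hK : duhamelKernel β x y = K at hid hKmin ⊢
  generalize ha : Real.exp (-(β * x)) = a at hid hKmin hapos ⊢
  generalize hu : β * (y - x) = u at hid hKmin ⊢
  -- now: hid : a − a e^{-u} = u K ; goal : (a + a e^{-u})/2 − K ≤ u/12 (a − a e^{-u})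
  rcases lt_trichotomy u 0 with hneg | hzero | hpos
  · -- u < 0 : −a ψ(−u) / (12 (−u)) ≤ 0 with e^{-u} = e^{v}, v = −u > 0
    have hv : 0 < -u := by linarith
    have hψ := harris_core_nonneg hv.le
    have hne : u ≠ 0 := hneg.ne
    have hKe : K = (a - a * Real.exp (-u)) / u := by
      field_simp
      linarith [hid]
    rw [hKe]
    have key : 0 ≤ a * (((-u) ^ 2 + 12) * (Real.exp (-u) - 1) - 6 * (-u) * (Real.exp (-u) + 1)) :=
      mul_nonneg hapos.le hψ
    have heq : (a + a * Real.exp (-u)) / 2 - (a - a * Real.exp (-u)) / u -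
        u / 12 * (a - a * Real.exp (-u))
        = -(a * (((-u) ^ 2 + 12) * (Real.exp (-u) - 1) - 6 * (-u) * (Real.exp (-u) + 1))) / (12 * (-u)) := by
      field_simp
      ring
    have hdiv : -(a * (((-u) ^ 2 + 12) * (Real.exp (-u) - 1) - 6 * (-u) * (Real.exp (-u) + 1))) /
        (12 * (-u)) ≤ 0 :=
      div_nonpos_of_nonpos_of_nonneg (neg_nonpos.2 key) (by linarith)
    rw [← heq] at hdiv
    linarith
  · -- u = 0 : a = b and K ≥ min(a, b) = a
    subst hzero
    rw [neg_zero, Real.exp_zero, mul_one, min_self] at hKmin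
    rw [neg_zero, Real.exp_zero, mul_one]
    linarith
  · -- u > 0 : −a ψ̃(u)/(12u) ≤ 0, ψ̃(u) = e^{-u} ψ(u)
    have hψ := harris_core_nonneg hpos.le
    have hne : u ≠ 0 := hpos.ne'
    have hKe : K = (a - a * Real.exp (-u)) / u := by
      field_simp
      linarith [hid]
    rw [hKe]
    have e1 : Real.exp (-u) * Real.exp u = 1 := by rw [← Real.exp_add]; simp
    have key : 0 ≤ a * ((u ^ 2 + 12) * (1 - Real.exp (-u)) - 6 * u * (1 + Real.exp (-u))) := by
      have h := mul_nonneg (mul_nonneg hapos.le (Real.exp_pos (-u)).le) hψ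
      have heq2 : a * Real.exp (-u) * ((u ^ 2 + 12) * (Real.exp u - 1) - 6 * u * (Real.exp u + 1)) =
          a * ((u ^ 2 + 12) * (1 - Real.exp (-u)) - 6 * u * (1 + Real.exp (-u))) := by
        calc a * Real.exp (-u) * ((u ^ 2 + 12) * (Real.exp u - 1) - 6 * u * (Real.exp u + 1))
            = a * ((u ^ 2 + 12) * (Real.exp (-u) * Real.exp u - Real.exp (-u)) -
                6 * u * (Real.exp (-u) * Real.exp u + Real.exp (-u))) := by ring
          _ = a * ((u ^ 2 + 12) * (1 - Real.exp (-u)) - 6 * u * (1 + Real.exp (-u))) := by rw [e1]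
      rwa [heq2] at h
    have heq : (a + a * Real.exp (-u)) / 2 - (a - a * Real.exp (-u)) / u -
        u / 12 * (a - a * Real.exp (-u))
        = -(a * ((u ^ 2 + 12) * (1 - Real.exp (-u)) - 6 * u * (1 + Real.exp (-u)))) / (12 * u) := by
      field_simp
      ring
    have hdiv : -(a * ((u ^ 2 + 12) * (1 - Real.exp (-u)) - 6 * u * (1 + Real.exp (-u)))) / (12 * u) ≤ 0 :=
      div_nonpos_of_nonpos_of_nonneg (neg_nonpos.2 key) (by linarith)
    rw [← heq] at hdiv
    linarith

/-- **The Bogoliubov–Harris inequality for a finite Gibbs state** (Harris 1967; Itoi et al. Thm 1,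
case `n = 2`, upper bound): for Hermitian `H`, EVERY real `β` (for `β < 0` it is the statement for
`−H` at `|β|`) and ANY matrix `A`, with the Duhamel
two-point function `(A, Aᴴ)_β = Matrix.duhamel β H A Aᴴ = Z⁻¹∫₀¹ tr(A e^{-sβH} Aᴴ e^{-(1-s)βH}) ds`,
`½(Re⟨AAᴴ⟩_β + Re⟨AᴴA⟩_β) − Re (A, Aᴴ)_β ≤ (β/12) · Re⟨[Aᴴ,[H,A]]⟩_β`
(printed: `½⟨{A†,A}⟩ − (A†,A) ≤ (β/12)⟨[A†,[H,A]]⟩`; the tree's `duhamel β H A Aᴴ` is the printed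
`(A†, A)` of the operator `A†`, and `⟨[A,[H,A†]]⟩ = ⟨[A†,[H,A]]⟩` for Gibbs states, so this is the
printed statement for `A†`). It complements the tree's companion `Re (A,Aᴴ) ≤ ½(Re⟨AAᴴ⟩ +
Re⟨AᴴA⟩)` ([DLS1978] (25), `re_duhamel_conjTranspose_le`). Proof: pair sums with the common weight
`‖A'ᵢⱼ‖²` and the per-frequency inequality `half_add_exp_sub_duhamelKernel_le` (`u coth u ≤ 1 + u²/3`).
[cite: ItoiEtAl2023, §2 Thm 1 (n = 2 case, upper bound = Bogoliubov–Harris inequality, displayed after Thm 4)] -/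
theorem IsHermitian.bogoliubov_harris (hH : H.IsHermitian) (β : ℝ) (A : Matrix n n ℂ) :
    ((gibbsState β H (A * Aᴴ)).re + (gibbsState β H (Aᴴ * A)).re) / 2 - (duhamel β H A Aᴴ).re ≤
      β / 12 * (gibbsState β H (Aᴴ * (H * A - A * H) - (H * A - A * H) * Aᴴ)).re := by
  set U := (hH.eigenvectorUnitary : Matrix n n ℂ) with hU
  set m : n → n → ℝ := fun i j => ‖(star U * A * U) i j‖ ^ 2 with hm
  set w : n → ℝ := fun i => Real.exp (-(β * hH.eigenvalues i)) with hw
  set E : n → ℝ := fun i => hH.eigenvalues i with hE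
  have hZ : 0 ≤ (∑ i, w i)⁻¹ := inv_nonneg.mpr (sum_nonneg fun i _ => (Real.exp_pos _).le)
  have h1 : (gibbsState β H (A * Aᴴ)).re = (∑ i, w i)⁻¹ * ∑ i, ∑ j, m i j * w i :=
    hH.re_gibbsState_self_mul_conjTranspose A β
  have h2 : (gibbsState β H (Aᴴ * A)).re = (∑ i, w i)⁻¹ * ∑ i, ∑ j, m i j * w j :=
    hH.re_gibbsState_conjTranspose_mul_self A β
  have h3 : (duhamel β H A Aᴴ).re = (∑ i, w i)⁻¹ * ∑ i, ∑ j, m i j * duhamelKernel β (E i) (E j) :=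
    Literature.MathematicalPhysics.QuantumLattice.re_duhamel_conjTranspose_eq hH A β
  have h4 : (gibbsState β H (Aᴴ * (H * A - A * H) - (H * A - A * H) * Aᴴ)).re =
      (∑ i, w i)⁻¹ * ∑ i, ∑ j, m i j * ((E j - E i) * (w i - w j)) :=
    Literature.MathematicalPhysics.QuantumLattice.re_gibbsState_doubleComm_general hH A β
  have key : ∑ i, ∑ j, ((m i j * w i + m i j * w j) / 2 - m i j * duhamelKernel β (E i) (E j)) ≤
      ∑ i, ∑ j, (β / 12 * (m i j * ((E j - E i) * (w i - w j)))) := by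
    refine sum_le_sum fun i _ => sum_le_sum fun j _ => ?_
    have h := mul_le_mul_of_nonneg_left (half_add_exp_sub_duhamelKernel_le β (E i) (E j))
      (sq_nonneg ‖(star U * A * U) i j‖)
    simp only [hw, hE, hm] at h ⊢
    linarith [h]
  set S1 := ∑ i, ∑ j, m i j * w i with hS1
  set S2 := ∑ i, ∑ j, m i j * w j with hS2
  set S3 := ∑ i, ∑ j, m i j * duhamelKernel β (E i) (E j) with hS3
  set S4 := ∑ i, ∑ j, m i j * ((E j - E i) * (w i - w j)) with hS4
  set Z := (∑ i, w i)⁻¹ with hZdef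
  have key' : (S1 + S2) / 2 - S3 ≤ β / 12 * S4 := by
    have eq1 : (S1 + S2) / 2 - S3 =
        ∑ i, ∑ j, ((m i j * w i + m i j * w j) / 2 - m i j * duhamelKernel β (E i) (E j)) := by
      rw [hS1, hS2, hS3, ← sum_add_distrib, Finset.sum_div, ← sum_sub_distrib]
      refine sum_congr rfl fun i _ => ?_
      rw [← sum_add_distrib, Finset.sum_div, ← sum_sub_distrib]
    have eq2 : β / 12 * S4 = ∑ i, ∑ j, (β / 12 * (m i j * ((E j - E i) * (w i - w j)))) := by
      rw [hS4, Finset.mul_sum]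
      refine sum_congr rfl fun i _ => ?_
      rw [Finset.mul_sum]
    rw [eq1, eq2]; exact key
  rw [h1, h2, h3, h4]
  have hfin := mul_le_mul_of_nonneg_left key' hZ
  calc (Z * S1 + Z * S2) / 2 - Z * S3 = Z * ((S1 + S2) / 2 - S3) := by ring
    _ ≤ Z * (β / 12 * S4) := hfin
    _ = β / 12 * (Z * S4) := by ring

end Spectral

end Matrix
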